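import Mathlib
import HarnessLib
import Summits.KontsevichZagierPeriods.Zeta5Search.Denom.CatalanRayDigitsB

/-!
# ζ(5) search — Legendre level sums and per-term allowances behind the odd denominators on the Catalan-box rays, Parts C–D (cell `pub-zeta5`, fam-denom K6)
HONEST FRAMING: systematic search; no irrationality claim unless certified. Nothing in this file mentions Catalan's
constant or an irrationality statement; it is elementary arithmetic of residues and factorials.

Continuation of `Denom/CatalanRayDigits.lean` and `CatalanRayDigitsB.lean` (the first file's module docstring is the
plan; CATK6.md §3–§5).  Part C — the `p`-adic valuations `vAlpha/vBeta/vGamma` of the factorial quotients of the three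
pole families as signed sums of `padicValNat p N!`, summed level by level (Legendre).  Part D — the per-term
allowances `termAlpha`, `termBetaB`, `termBetaA`, `termGamma` of CATK6 §5 on the rays `J ≥ 3n` (odd `p`), which
`Denom/CatalanRayPClosedOdd.lean` combines with the atom lemmas of `Denom/CatalanRayAtoms.lean`.
-/

namespace Summit.KontsevichZagierPeriods.Zeta5Search.Denom.CatalanRayDigits

/-! ### Part C — summation over the levels (Legendre): the factorial parts of the three term types

`vAlpha`, `vBeta`, `vGamma` are the `p`-adic valuations (signed sums of `padicValNat p N!`) of the factorial quotients
of the type-α / β / γ pole coefficients of CATK6 §2 (up to the atoms `gsum`, `W`, `σ`, `Λ` and powers of 2, which are not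
treated here). By Legendre's formula (`padicValNat_factorial`) they are the level sums of the floor forms, hence:
type α is `≥ 0` at EVERY prime (an integrality statement), type β is `≥ 0` at every odd prime, type γ is
`≥ −⌊log_p (2a−1)⌋` at every odd prime (`d_{2a−1}` clears it). -/

/-- `v_p` of the type-α factorial quotient `(2n)!(2m)!(2c+2n)!(2c)! / (n! m! (c+n)!² c! (m−n)! (c+2n)!)`. -/
def vAlpha (p n c m : ℕ) : ℤ :=
  ((padicValNat p (2 * n).factorial : ℕ) : ℤ) + (padicValNat p (2 * m).factorial : ℕ)
    + (padicValNat p (2 * (c + n)).factorial : ℕ) + (padicValNat p (2 * c).factorial : ℕ)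
    - (padicValNat p n.factorial : ℕ) - (padicValNat p m.factorial : ℕ)
    - 2 * ((padicValNat p (c + n).factorial : ℕ) : ℤ) - (padicValNat p c.factorial : ℕ)
    - (padicValNat p (m - n).factorial : ℕ) - (padicValNat p (c + 2 * n).factorial : ℕ)

/-- Legendre: `vAlpha p n c m` is the sum over the levels `q = p^i`, `1 ≤ i < b` (`p^b` beyond every argument), of the one-level digit function `FdigFloor`. -/
theorem vAlpha_eq_sum (p : ℕ) [hp : Fact p.Prime] (n c m b : ℕ) (hb : Nat.log p (2 * (c + n + m)) < b) :
    vAlpha p n c m = ∑ i ∈ Finset.Ico 1 b, FdigFloor (p ^ i) n c m := by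
  have hl : ∀ N, N ≤ 2 * (c + n + m) → Nat.log p N < b :=
    fun N h => lt_of_le_of_lt (Nat.log_mono_right h) hb
  unfold vAlpha
  rw [padicValNat_factorial (hl (2 * n) (by omega)), padicValNat_factorial (hl (2 * m) (by omega)),
    padicValNat_factorial (hl (2 * (c + n)) (by omega)), padicValNat_factorial (hl (2 * c) (by omega)),
    padicValNat_factorial (hl n (by omega)), padicValNat_factorial (hl m (by omega)),
    padicValNat_factorial (hl (c + n) (by omega)), padicValNat_factorial (hl c (by omega)),
    padicValNat_factorial (hl (m - n) (by omega)), padicValNat_factorial (hl (c + 2 * n) (by omega))]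
  simp only [FdigFloor, Finset.sum_add_distrib, Finset.sum_sub_distrib, ← Finset.mul_sum, Nat.cast_sum]
  ring

/-- Type α: the factorial quotient is an INTEGER at every prime (F0 at every level), for `n ≤ m`. -/
theorem vAlpha_nonneg (p : ℕ) [hp : Fact p.Prime] (n c m : ℕ) (hnm : n ≤ m) : 0 ≤ vAlpha p n c m := by
  rw [vAlpha_eq_sum p n c m (Nat.log p (2 * (c + n + m)) + 1) (by omega)]
  exact Finset.sum_nonneg (fun i _ => FdigFloor_nonneg _ _ _ _ (pow_pos hp.out.pos i) hnm)

/-- `v_p` of the type-β factorial quotient `(2n)!(2X)!(2n−2a)!(a−1)! / (n! X! (X−n)! ((n−a)!)² (2n−a)! (2a−1)!)`. -/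
def vBeta (p n a X : ℕ) : ℤ :=
  ((padicValNat p (2 * n).factorial : ℕ) : ℤ) - (padicValNat p n.factorial : ℕ)
    + (padicValNat p (2 * X).factorial : ℕ) - (padicValNat p X.factorial : ℕ)
    - (padicValNat p (X - n).factorial : ℕ) + (padicValNat p (2 * n - 2 * a).factorial : ℕ)
    - 2 * ((padicValNat p (n - a).factorial : ℕ) : ℤ) + (padicValNat p (a - 1).factorial : ℕ)
    - (padicValNat p (2 * n - a).factorial : ℕ) - (padicValNat p (2 * a - 1).factorial : ℕ)

/-- Legendre: `vBeta p n a X` is the sum over the levels `q = p^i`, `1 ≤ i < b`, of `HdigFloor`. -/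
theorem vBeta_eq_sum (p : ℕ) [hp : Fact p.Prime] (n a X b : ℕ) (han : a ≤ n) (hnX : n ≤ X)
    (hb : Nat.log p (2 * X + 2 * n) < b) :
    vBeta p n a X = ∑ i ∈ Finset.Ico 1 b, HdigFloor (p ^ i) n a X := by
  have hl : ∀ N, N ≤ 2 * X + 2 * n → Nat.log p N < b :=
    fun N h => lt_of_le_of_lt (Nat.log_mono_right h) hb
  unfold vBeta
  rw [padicValNat_factorial (hl (2 * n) (by omega)), padicValNat_factorial (hl n (by omega)),
    padicValNat_factorial (hl (2 * X) (by omega)), padicValNat_factorial (hl X (by omega)),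
    padicValNat_factorial (hl (X - n) (by omega)), padicValNat_factorial (hl (2 * n - 2 * a) (by omega)),
    padicValNat_factorial (hl (n - a) (by omega)), padicValNat_factorial (hl (a - 1) (by omega)),
    padicValNat_factorial (hl (2 * n - a) (by omega)), padicValNat_factorial (hl (2 * a - 1) (by omega))]
  simp only [HdigFloor, Finset.sum_add_distrib, Finset.sum_sub_distrib, ← Finset.mul_sum, Nat.cast_sum]

/-- Type β: at every ODD prime the factorial quotient has `v_p ≥ 0` (H0 at every level), for `1 ≤ a ≤ n ≤ X`. -/
theorem vBeta_nonneg (p : ℕ) [hp : Fact p.Prime] (hodd : p % 2 = 1) (n a X : ℕ) (ha : 1 ≤ a) (han : a ≤ n)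
    (hnX : n ≤ X) : 0 ≤ vBeta p n a X := by
  rw [vBeta_eq_sum p n a X (Nat.log p (2 * X + 2 * n) + 1) han hnX (by omega)]
  refine Finset.sum_nonneg (fun i _ => HdigFloor_nonneg _ _ _ _ (pow_pos hp.out.pos i) ?_ ha han hnX)
  exact Nat.odd_iff.mp (Odd.pow (Nat.odd_iff.mpr hodd))

/-- `v_p` of the type-γ factorial quotient
`(2n)!(2X)!(a−n)!(a−n−1)!(a−1)! / (n! X! (X−n)! (2a−2n)! (2n−a)! (2a−1)!)`. -/
def vGamma (p n a X : ℕ) : ℤ :=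
  ((padicValNat p (2 * n).factorial : ℕ) : ℤ) - (padicValNat p n.factorial : ℕ)
    + (padicValNat p (2 * X).factorial : ℕ) - (padicValNat p X.factorial : ℕ)
    - (padicValNat p (X - n).factorial : ℕ) + (padicValNat p (a - n).factorial : ℕ)
    + (padicValNat p (a - n - 1).factorial : ℕ) + (padicValNat p (a - 1).factorial : ℕ)
    - (padicValNat p (2 * a - 2 * n).factorial : ℕ) - (padicValNat p (2 * n - a).factorial : ℕ)
    - (padicValNat p (2 * a - 1).factorial : ℕ)

/-- Legendre: `vGamma p n a X` is the sum over the levels `q = p^i`, `1 ≤ i < b`, of `GdigFloor`. -/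
theorem vGamma_eq_sum (p : ℕ) [hp : Fact p.Prime] (n a X b : ℕ) (ha2 : a ≤ 2 * n) (hnX : n ≤ X)
    (hb : Nat.log p (2 * X + 2 * a) < b) :
    vGamma p n a X = ∑ i ∈ Finset.Ico 1 b, GdigFloor (p ^ i) n a X := by
  have hl : ∀ N, N ≤ 2 * X + 2 * a → Nat.log p N < b :=
    fun N h => lt_of_le_of_lt (Nat.log_mono_right h) hb
  unfold vGamma
  rw [padicValNat_factorial (hl (2 * n) (by omega)), padicValNat_factorial (hl n (by omega)),
    padicValNat_factorial (hl (2 * X) (by omega)), padicValNat_factorial (hl X (by omega)),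
    padicValNat_factorial (hl (X - n) (by omega)), padicValNat_factorial (hl (a - n) (by omega)),
    padicValNat_factorial (hl (a - n - 1) (by omega)), padicValNat_factorial (hl (a - 1) (by omega)),
    padicValNat_factorial (hl (2 * a - 2 * n) (by omega)), padicValNat_factorial (hl (2 * n - a) (by omega)),
    padicValNat_factorial (hl (2 * a - 1) (by omega))]
  simp only [GdigFloor, Finset.sum_add_distrib, Finset.sum_sub_distrib, Nat.cast_sum]

/-- Above the last level that `(2a−1)!` sees, the type-γ floor form is `≥ 0` (no negative quotient survives). -/
theorem GdigFloor_nonneg_of_lt (q n a X : ℕ) (hq : 2 * a - 1 < q) (hodd : q % 2 = 1) (hna : n < a)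
    (ha2 : a ≤ 2 * n) (hnX : n ≤ X) : 0 ≤ GdigFloor q n a X := by
  have hq0 : 0 < q := by omega
  rw [GdigFloor_eq q n a X hq0 hodd hna ha2 hnX, Nat.mod_eq_of_lt (show n < q by omega),
    Nat.mod_eq_of_lt (show a < q by omega)]
  have hz := Nat.mod_lt X hq0
  unfold Gdig th thSub carry2 ind
  split_ifs <;> omega

/-- Type γ, level count: `Σ_{1 ≤ i < b} GdigFloor(p^i) ≥ −min(⌊log_p(2a−1)⌋, b−1)` for odd `p`. -/
theorem GdigFloor_sum_ge (p : ℕ) [hp : Fact p.Prime] (hodd : p % 2 = 1) (n a X : ℕ) (hna : n < a)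
    (ha2 : a ≤ 2 * n) (hnX : n ≤ X) :
    ∀ b : ℕ, -((min (Nat.log p (2 * a - 1)) (b - 1) : ℕ) : ℤ) ≤ ∑ i ∈ Finset.Ico 1 b, GdigFloor (p ^ i) n a X := by
  intro b
  induction b with
  | zero => simp
  | succ b ih =>
    rcases Nat.eq_zero_or_pos b with rfl | hb
    · simp
    · rw [Finset.sum_Ico_succ_top hb]
      have hq0 : 0 < p ^ b := pow_pos hp.out.pos b
      have hqodd : (p ^ b) % 2 = 1 := Nat.odd_iff.mp (Odd.pow (Nat.odd_iff.mpr hodd))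
      by_cases hL : b ≤ Nat.log p (2 * a - 1)
      · have h1 := GdigFloor_ge_neg_one (p ^ b) n a X hq0 hqodd hna ha2 hnX
        have e : (min (Nat.log p (2 * a - 1)) (b + 1 - 1) : ℕ) = min (Nat.log p (2 * a - 1)) (b - 1) + 1 := by
          omega
        rw [e, Nat.cast_add, Nat.cast_one]
        linarith
      · have hL' : Nat.log p (2 * a - 1) < b := Nat.lt_of_not_le hL
        have hlt : 2 * a - 1 < p ^ b := Nat.lt_pow_of_log_lt hp.out.one_lt hL'
        have h0 := GdigFloor_nonneg_of_lt (p ^ b) n a X hlt hqodd hna ha2 hnX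
        have e : (min (Nat.log p (2 * a - 1)) (b + 1 - 1) : ℕ) = min (Nat.log p (2 * a - 1)) (b - 1) := by
          omega
        rw [e]
        linarith

/-- Type γ: at every ODD prime the factorial quotient has `v_p ≥ −⌊log_p (2a−1)⌋ = −v_p(d_{2a−1})`, for
`n < a ≤ 2n`, `n ≤ X` (G1 at the levels `p^i ≤ 2a−1`, `≥ 0` above). -/
theorem vGamma_ge (p : ℕ) [hp : Fact p.Prime] (hodd : p % 2 = 1) (n a X : ℕ) (hna : n < a) (ha2 : a ≤ 2 * n)
    (hnX : n ≤ X) : -(Nat.log p (2 * a - 1) : ℤ) ≤ vGamma p n a X := by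
  set B := Nat.log p (2 * X + 2 * a) + 1 with hB
  rw [vGamma_eq_sum p n a X B ha2 hnX (by omega)]
  have h := GdigFloor_sum_ge p hodd n a X hna ha2 hnX B
  have hmin : ((min (Nat.log p (2 * a - 1)) (B - 1) : ℕ) : ℤ) ≤ (Nat.log p (2 * a - 1) : ℤ) :=
    Nat.cast_le.mpr (min_le_left _ _)
  linarith


/-! ### Part D — the level-by-level assembly of CATK6 §5 for the factorial parts (rays, `j ≥ 3`)

On the ray, write `J := jn` (only `J ≥ 3n` is used), `L := J + n`, `E := max J (4n−1)`; the ALLOWANCE of a level `q`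
is `[q ≤ L] + [q ≤ E]`. Atom costs charged to a level (CATK6 §3): `gsum(c)` 2 per level `q ≤ 2c−1`, `W(a)` 2 and
`σ(a)` 1 per level `q ≤ 2a−1`, `Λ_a` 1 per level `q ≤ 2X−1`. The four per-level inequalities
"digit − cost ≥ −allowance" (`levelAlpha`, `levelBetaB`, `levelBetaA`, `levelGamma`) and their sums over the levels
(`termAlpha`, `termBetaB`, `termBetaA`, `termGamma`): `v_p(factorial part) − (atom cost)·T ≥ −(T_L + T_E)` with
`T_N = ⌊log_p N⌋ = v_p(d*_N)` for odd `p`. What then remains for Theorem K6 is only: the closed forms of §2 (that the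
pole coefficients of `R_n` are these factorial quotients times the atoms times powers of 2) and the atom bounds of §3. -/

set_option maxHeartbeats 400000 in
/-- Level inequality, type α (`1 ≤ c ≤ J − n`, `m = J − c`; any `q > 0`): `F − 2[q ≤ 2c−1] ≥ −[q ≤ L] − [q ≤ E]`. -/
theorem levelAlpha (q n J c : ℕ) (hq : 0 < q) (hJ : 3 * n ≤ J) (hc1 : 1 ≤ c) (hc : c + n ≤ J) :
    -(ind (q ≤ J + n) + ind (q ≤ max J (4 * n - 1)))
      ≤ FdigFloor q n c (J - c) - 2 * ind (q ≤ 2 * c - 1) := by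
  rw [FdigFloor_eq q n c (J - c) hq (by omega)]
  by_cases hE : q ≤ max J (4 * n - 1)
  · have h0 := F0 q (n % q) (c % q) ((J - c) % q) (Nat.mod_lt _ hq) (Nat.mod_lt _ hq) (Nat.mod_lt _ hq)
    have hL : q ≤ J + n := by
      rcases le_max_iff.mp hE with h | h <;> omega
    unfold ind
    rw [if_pos hL, if_pos hE]
    split_ifs <;> omega
  · have hE' : max J (4 * n - 1) < q := Nat.lt_of_not_le hE
    have hJq : J < q := lt_of_le_of_lt (le_max_left _ _) hE'
    have h4q : 4 * n - 1 < q := lt_of_le_of_lt (le_max_right _ _) hE'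
    rw [Nat.mod_eq_of_lt (show n < q by omega), Nat.mod_eq_of_lt (show c < q by omega),
      Nat.mod_eq_of_lt (show J - c < q by omega)]
    unfold Fdig carryF thAdd th ind
    rw [if_neg hE, if_neg (show ¬(2 * q ≤ c + 2 * n) by omega), if_neg (show ¬(q ≤ 2 * n) by omega),
      if_pos (show c + n < q by omega)]
    split_ifs <;> omega

/-- Level inequality, type βB (`1 ≤ a ≤ n`, `X = a + J`; `q` odd): `H − 2[q ≤ 2a−1] ≥ −[q ≤ L] − [q ≤ E]`. -/
theorem levelBetaB (q n J a : ℕ) (hq : 0 < q) (hodd : q % 2 = 1) (hJ : 3 * n ≤ J) (ha1 : 1 ≤ a) (ha : a ≤ n) :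
    -(ind (q ≤ J + n) + ind (q ≤ max J (4 * n - 1)))
      ≤ HdigFloor q n a (a + J) - 2 * ind (q ≤ 2 * a - 1) := by
  have h0 := HdigFloor_nonneg q n a (a + J) hq hodd ha1 ha (by omega)
  unfold ind
  by_cases hc : q ≤ 2 * a - 1
  · have hE : q ≤ max J (4 * n - 1) := le_max_of_le_right (by omega)
    rw [if_pos hc, if_pos hE, if_pos (show q ≤ J + n by omega)]
    linarith
  · rw [if_neg hc]
    split_ifs <;> linarith

/-- Level inequality, type βA′ (`1 ≤ a ≤ n`, `X = a + J`; `q` odd):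
`H − [q ≤ 2a−1] − [q ≤ 2X−1] ≥ −[q ≤ L] − [q ≤ E]` (H1 at the one level `L < q ≤ 2X−1`). -/
theorem levelBetaA (q n J a : ℕ) (hq : 0 < q) (hodd : q % 2 = 1) (hJ : 3 * n ≤ J) (ha1 : 1 ≤ a) (ha : a ≤ n) :
    -(ind (q ≤ J + n) + ind (q ≤ max J (4 * n - 1)))
      ≤ HdigFloor q n a (a + J) - ind (q ≤ 2 * a - 1) - ind (q ≤ 2 * (a + J) - 1) := by
  by_cases hL : q ≤ J + n
  · have h0 := HdigFloor_nonneg q n a (a + J) hq hodd ha1 ha (by omega)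
    unfold ind
    rw [if_pos hL]
    by_cases hc : q ≤ 2 * a - 1
    · have hE : q ≤ max J (4 * n - 1) := le_max_of_le_right (by omega)
      rw [if_pos hc, if_pos hE]
      split_ifs <;> linarith
    · rw [if_neg hc]
      split_ifs <;> linarith
  · have hL' : J + n < q := Nat.lt_of_not_le hL
    rw [HdigFloor_eq q n a (a + J) hq hodd ha1 ha (by omega), Nat.mod_eq_of_lt (show n < q by omega),
      Nat.mod_eq_of_lt (show a < q by omega), Nat.mod_eq_of_lt (show a + J < q by omega)]
    have hE : ¬ q ≤ max J (4 * n - 1) := fun h => by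
      rcases le_max_iff.mp h with h' | h' <;> omega
    unfold Hdig thSub carry2 th ind
    rw [if_neg hL, if_neg hE]
    split_ifs <;> omega

/-- Level inequality, type γ (`n < a ≤ 2n`, `X = a + J`; `q` odd): `G − [q ≤ 2a−1] ≥ −[q ≤ L] − [q ≤ E]`. -/
theorem levelGamma (q n J a : ℕ) (hq : 0 < q) (hodd : q % 2 = 1) (hJ : 3 * n ≤ J) (hna : n < a)
    (ha2 : a ≤ 2 * n) :
    -(ind (q ≤ J + n) + ind (q ≤ max J (4 * n - 1)))
      ≤ GdigFloor q n a (a + J) - ind (q ≤ 2 * a - 1) := by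
  unfold ind
  by_cases hc : q ≤ 2 * a - 1
  · have h1 := GdigFloor_ge_neg_one q n a (a + J) hq hodd hna ha2 (by omega)
    have hE : q ≤ max J (4 * n - 1) := le_max_of_le_right (by omega)
    rw [if_pos hc, if_pos hE, if_pos (show q ≤ J + n by omega)]
    linarith
  · have h0 := GdigFloor_nonneg_of_lt q n a (a + J) (Nat.lt_of_not_le hc) hodd hna ha2 (by omega)
    rw [if_neg hc]
    split_ifs <;> linarith

/-- Counting levels: `Σ_{1 ≤ i < b} [p^i ≤ N] = min(⌊log_p N⌋, b−1)` (`N ≠ 0`, `p > 1`). -/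
lemma sum_ind_pow_le (p : ℕ) (hp : 1 < p) (N : ℕ) (hN : N ≠ 0) :
    ∀ b : ℕ, ∑ i ∈ Finset.Ico 1 b, ind (p ^ i ≤ N) = ((min (Nat.log p N) (b - 1) : ℕ) : ℤ) := by
  intro b
  induction b with
  | zero => simp
  | succ b ih =>
    rcases Nat.eq_zero_or_pos b with rfl | hb
    · simp
    · rw [Finset.sum_Ico_succ_top hb, ih]
      unfold ind
      by_cases hle : p ^ b ≤ N
      · have hlog : b ≤ Nat.log p N := Nat.le_log_of_pow_le hp hle
        have e : min (Nat.log p N) (b + 1 - 1) = min (Nat.log p N) (b - 1) + 1 := by omega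
        rw [if_pos hle, e, Nat.cast_add, Nat.cast_one]
      · have hlog : ¬ b ≤ Nat.log p N := fun h =>
          hle ((Nat.pow_le_pow_right (by omega) h).trans (Nat.pow_log_le_self p hN))
        have e : min (Nat.log p N) (b + 1 - 1) = min (Nat.log p N) (b - 1) := by omega
        rw [if_neg hle, e, add_zero]

/-- From per-level inequalities to valuations: generic summation with allowances and one atom cost. -/
lemma sum_levels (p : ℕ) [hp : Fact p.Prime] (D : ℕ → ℤ) (L E N : ℕ) (κ : ℤ) (hL : L ≠ 0) (hE : E ≠ 0)
    (hN : N ≠ 0) (b : ℕ) (hbL : Nat.log p L < b) (hbE : Nat.log p E < b) (hbN : Nat.log p N < b)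
    (h : ∀ i ∈ Finset.Ico 1 b, -(ind (p ^ i ≤ L) + ind (p ^ i ≤ E)) ≤ D (p ^ i) - κ * ind (p ^ i ≤ N)) :
    -((Nat.log p L : ℤ) + Nat.log p E) ≤ (∑ i ∈ Finset.Ico 1 b, D (p ^ i)) - κ * Nat.log p N := by
  have S := Finset.sum_le_sum h
  simp only [Finset.sum_neg_distrib, Finset.sum_add_distrib, Finset.sum_sub_distrib, ← Finset.mul_sum,
    sum_ind_pow_le p hp.out.one_lt L hL, sum_ind_pow_le p hp.out.one_lt E hE,
    sum_ind_pow_le p hp.out.one_lt N hN] at S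
  rw [min_eq_left (by omega : Nat.log p L ≤ b - 1), min_eq_left (by omega : Nat.log p E ≤ b - 1),
    min_eq_left (by omega : Nat.log p N ≤ b - 1)] at S
  exact S

/-- Same with two atom costs (type βA′: `σ` and `Λ`). -/
lemma sum_levels2 (p : ℕ) [hp : Fact p.Prime] (D : ℕ → ℤ) (L E N N' : ℕ) (hL : L ≠ 0) (hE : E ≠ 0)
    (hN : N ≠ 0) (hN' : N' ≠ 0) (b : ℕ) (hbL : Nat.log p L < b) (hbE : Nat.log p E < b) (hbN : Nat.log p N < b)
    (hbN' : Nat.log p N' < b)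
    (h : ∀ i ∈ Finset.Ico 1 b,
      -(ind (p ^ i ≤ L) + ind (p ^ i ≤ E)) ≤ D (p ^ i) - ind (p ^ i ≤ N) - ind (p ^ i ≤ N')) :
    -((Nat.log p L : ℤ) + Nat.log p E) ≤ (∑ i ∈ Finset.Ico 1 b, D (p ^ i)) - Nat.log p N - Nat.log p N' := by
  have S := Finset.sum_le_sum h
  simp only [Finset.sum_neg_distrib, Finset.sum_add_distrib, Finset.sum_sub_distrib,
    sum_ind_pow_le p hp.out.one_lt L hL, sum_ind_pow_le p hp.out.one_lt E hE,
    sum_ind_pow_le p hp.out.one_lt N hN, sum_ind_pow_le p hp.out.one_lt N' hN'] at S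
  rw [min_eq_left (by omega : Nat.log p L ≤ b - 1), min_eq_left (by omega : Nat.log p E ≤ b - 1),
    min_eq_left (by omega : Nat.log p N ≤ b - 1), min_eq_left (by omega : Nat.log p N' ≤ b - 1)] at S
  exact S

/-- TERM BOUND, type α (CATK6 §5; every prime `p`, `J ≥ 3n`, `1 ≤ c ≤ J−n`, `m = J−c`):
`v_p(factorial part of α_c) − 2·T_{2c−1} ≥ −(T_{J+n} + T_{max(J,4n−1)})`. -/
theorem termAlpha (p : ℕ) [hp : Fact p.Prime] (n J c : ℕ) (hJ : 3 * n ≤ J) (hc1 : 1 ≤ c) (hc : c + n ≤ J) :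
    -((Nat.log p (J + n) : ℤ) + Nat.log p (max J (4 * n - 1)))
      ≤ vAlpha p n c (J - c) - 2 * Nat.log p (2 * c - 1) := by
  set b := Nat.log p (4 * (J + n)) + 1 with hb
  have hl : ∀ M, M ≤ 4 * (J + n) → Nat.log p M < b :=
    fun M h => Nat.lt_succ_of_le (Nat.log_mono_right h)
  rw [vAlpha_eq_sum p n c (J - c) b (hl _ (by omega))]
  refine sum_levels p (fun q => FdigFloor q n c (J - c)) (J + n) (max J (4 * n - 1)) (2 * c - 1) 2
    (by omega) (by have := le_max_left J (4 * n - 1); omega) (by omega) b (hl _ (by omega))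
    (hl _ (max_le (by omega) (by omega))) (hl _ (by omega)) ?_
  intro i _
  exact levelAlpha (p ^ i) n J c (pow_pos hp.out.pos i) hJ hc1 hc

/-- TERM BOUND, type βB (odd `p`, `1 ≤ a ≤ n ≤ J/3`): `v_p(factorial part of B_a) − 2·T_{2a−1} ≥ −(T_L + T_E)`. -/
theorem termBetaB (p : ℕ) [hp : Fact p.Prime] (hodd : p % 2 = 1) (n J a : ℕ) (hJ : 3 * n ≤ J) (ha1 : 1 ≤ a)
    (ha : a ≤ n) :
    -((Nat.log p (J + n) : ℤ) + Nat.log p (max J (4 * n - 1)))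
      ≤ vBeta p n a (a + J) - 2 * Nat.log p (2 * a - 1) := by
  set b := Nat.log p (4 * (J + n)) + 1 with hb
  have hl : ∀ M, M ≤ 4 * (J + n) → Nat.log p M < b :=
    fun M h => Nat.lt_succ_of_le (Nat.log_mono_right h)
  rw [vBeta_eq_sum p n a (a + J) b ha (by omega) (hl _ (by omega))]
  refine sum_levels p (fun q => HdigFloor q n a (a + J)) (J + n) (max J (4 * n - 1)) (2 * a - 1) 2
    (by omega) (by have := le_max_left J (4 * n - 1); omega) (by omega) b (hl _ (by omega))
    (hl _ (max_le (by omega) (by omega))) (hl _ (by omega)) ?_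
  intro i _
  have hqodd : (p ^ i) % 2 = 1 := Nat.odd_iff.mp (Odd.pow (Nat.odd_iff.mpr hodd))
  exact levelBetaB (p ^ i) n J a (pow_pos hp.out.pos i) hqodd hJ ha1 ha

/-- TERM BOUND, type βA′ (odd `p`): `v_p(factorial part) − T_{2a−1} − T_{2X−1} ≥ −(T_L + T_E)`, `X = a + J`. -/
theorem termBetaA (p : ℕ) [hp : Fact p.Prime] (hodd : p % 2 = 1) (n J a : ℕ) (hJ : 3 * n ≤ J) (ha1 : 1 ≤ a)
    (ha : a ≤ n) :
    -((Nat.log p (J + n) : ℤ) + Nat.log p (max J (4 * n - 1)))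
      ≤ vBeta p n a (a + J) - Nat.log p (2 * a - 1) - Nat.log p (2 * (a + J) - 1) := by
  set b := Nat.log p (4 * (J + n)) + 1 with hb
  have hl : ∀ M, M ≤ 4 * (J + n) → Nat.log p M < b :=
    fun M h => Nat.lt_succ_of_le (Nat.log_mono_right h)
  rw [vBeta_eq_sum p n a (a + J) b ha (by omega) (hl _ (by omega))]
  refine sum_levels2 p (fun q => HdigFloor q n a (a + J)) (J + n) (max J (4 * n - 1)) (2 * a - 1)
    (2 * (a + J) - 1) (by omega) (by have := le_max_left J (4 * n - 1); omega) (by omega)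
    (by omega) b (hl _ (by omega)) (hl _ (max_le (by omega) (by omega))) (hl _ (by omega)) (hl _ (by omega)) ?_
  intro i _
  have hqodd : (p ^ i) % 2 = 1 := Nat.odd_iff.mp (Odd.pow (Nat.odd_iff.mpr hodd))
  exact levelBetaA (p ^ i) n J a (pow_pos hp.out.pos i) hqodd hJ ha1 ha

/-- TERM BOUND, type γ (odd `p`, `n < a ≤ 2n`): `v_p(factorial part) − T_{2a−1} ≥ −(T_L + T_E)`, `X = a + J`. -/
theorem termGamma (p : ℕ) [hp : Fact p.Prime] (hodd : p % 2 = 1) (n J a : ℕ) (hJ : 3 * n ≤ J) (hna : n < a)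
    (ha2 : a ≤ 2 * n) :
    -((Nat.log p (J + n) : ℤ) + Nat.log p (max J (4 * n - 1)))
      ≤ vGamma p n a (a + J) - Nat.log p (2 * a - 1) := by
  set b := Nat.log p (4 * (J + n)) + 1 with hb
  have hl : ∀ M, M ≤ 4 * (J + n) → Nat.log p M < b :=
    fun M h => Nat.lt_succ_of_le (Nat.log_mono_right h)
  rw [vGamma_eq_sum p n a (a + J) b ha2 (by omega) (hl _ (by omega))]
  have := sum_levels p (fun q => GdigFloor q n a (a + J)) (J + n) (max J (4 * n - 1)) (2 * a - 1) 1
    (by omega) (by have := le_max_left J (4 * n - 1); omega) (by omega) b (hl _ (by omega))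
    (hl _ (max_le (by omega) (by omega))) (hl _ (by omega)) (fun i _ => by
      have hqodd : (p ^ i) % 2 = 1 := Nat.odd_iff.mp (Odd.pow (Nat.odd_iff.mpr hodd))
      simpa using levelGamma (p ^ i) n J a (pow_pos hp.out.pos i) hqodd hJ hna ha2)
  simpa using this

end Summit.KontsevichZagierPeriods.Zeta5Search.Denom.CatalanRayDigits
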